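import Mathlib
import Summits.NavierStokesRegularity.NavierStokesRegularity.Theorems.EulerZoomLiouvillePowerGaugeEulerLiouvilleSelfSimilarIrrotationalGrowth
import Summits.NavierStokesRegularity.NavierStokesRegularity.Theorems.EulerZoomLiouvillePowerGaugeEulerLiouvilleSelfSimilarRadialBarrierLoc
import HarnessLib

/-!
# The SHIFTED radial-inflow stratum of crux E: an exactly self-similar member about ANY blow-up point `(T, x₀)`, `T ≥ 0`, whose `C²`
# velocity profile has NO FAST RADIAL INFLOW at infinity is trivial
# (crux E = stmt-NavierStokesRegularity-19832, line `birth`, rung C1)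

Route №10 `EulerZoomLiouville` (NavierStokesRegularity).  Interim LEAD ns-typeII-p2 g9; shifted twin of ns-typeII-p1 g8's
`Loc.selfSimilar_ae_eq_zero_of_radialInflowC2_profile` (`…SelfSimilarRadialBarrierLoc`, p593082: the ONE-SIDED barrier — backward similarity
orbits are confined as soon as `⟪y, V(y)⟫ ≥ −κ‖y‖²` on large spheres for some `κ < γ`, outward and tangential growth being free — run on
HALF-orbits (`…SelfSimilarHalfOrbitKit/Kill`), giving `curl V ≡ 0` via `Loc.curl_eq_zero_of_radialInflow`).  For a member exactly self-similar
about `(T, x₀)` the origin-centred EXTENSION supplies CIV (3.3) (`Shifted.isDistributional_selfSimilarCollapse_of_shifted`,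
`WeakToClassical.exists_isSelfSimilarEulerProfile_of_contDiff`, `P ∈ L¹_loc` from the slab), and the growth-free irrotational endgame for shifted
members (`Shifted.selfSimilar_ae_eq_zero_of_irrotationalC2_profile`, p592386: the member's own `A`-gauge at large profile scales) concludes.

* `Shifted.selfSimilar_ae_eq_zero_of_radialInflowC2_profile` — `0 < ρ ≤ ½`; distributional Euler pair + `A`-gauge + exact self-similarity
  about `(T, x₀)`, `T ≥ 0` + `V ∈ C²` + `∃ κ < 1/(2+ρ), R₁: ∀ ‖y‖ ≥ R₁, −κ‖y‖² ≤ ⟪y, V y⟫` ⇒ `u = 0` a.e.  Contains the shifted sub-drift /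
  `o(|y|)` / bounded strata (`Loc.radialInflow_of_subdrift`).

WHAT THIS IS NOT: not NS, not E — a classical sub-stratum `--supports` stmt-19832; `C²` profiles with fast radial INFLOW along a sparse set
(p1 g8's vortical-escape portrait `…SelfSimilarVorticalEscape`), the weak class and the genuinely non-self-similar members stay OPEN. [folklore]
-/

noncomputable section

-- flat `Theorems/<Route><Decl>…` files of one crux share the namespace of the crux (tree convention: `Summit.<S>.<S>.…`)
set_option linter.dupNamespace false

open MeasureTheory Set Filter Topology Metric Function InnerProductSpace TopologicalSpace
open scoped RealInnerProductSpace NNReal ENNReal ContDiff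

namespace Summit.NavierStokesRegularity.NavierStokesRegularity.Theorems.PowerGaugeEulerLiouville

open Literature.Analysis Literature.Analysis.FunctionSpaces Literature.Analysis.FluidPDE

namespace Shifted

/-- **THE SHIFTED RADIAL-INFLOW STRATUM, MEMBER LEVEL** (`0 < ρ ≤ ½`).  Let `(u, p)` be a distributional Euler pair on `(−∞,0) × ℝ³` with
`a^{2ρ} A(a; 0) ≤ c` for all `a > 0`, exactly self-similar about the space–time point `(T, x₀)`, `T ≥ 0`, with the class exponent
`γ = 1/(2+ρ)` and profile `(V, P)`.  If `V ∈ C²` and, for some `κ < γ` and `R₁`, `⟪y, V y⟫ ≥ −κ‖y‖²` whenever `‖y‖ ≥ R₁` (no fast radial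
inflow at infinity; outward and tangential growth free), then `u = 0` a.e. on `(−∞,0) × ℝ³`. [folklore] -/
theorem selfSimilar_ae_eq_zero_of_radialInflowC2_profile {ρ : ℝ} (hρ : 0 < ρ) (hρh : ρ ≤ 1 / 2) {T : ℝ} (hT : 0 ≤ T)
    (x₀ : EuclideanSpace ℝ (Fin 3))
    {u : ℝ → EuclideanSpace ℝ (Fin 3) → EuclideanSpace ℝ (Fin 3)} {p : ℝ → EuclideanSpace ℝ (Fin 3) → ℝ} {c : ℝ≥0}
    (hsol : IsDistributionalNSSolutionOn (slab (EuclideanSpace ℝ (Fin 3)) (Iio 0) isOpen_Iio) 0 0 u p)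
    (hA : ∀ a : ℝ, 0 < a → ENNReal.ofReal (a ^ (2 * ρ)) *
      cknA a (0 : ℝ × EuclideanSpace ℝ (Fin 3)) u ≤ (c : ℝ≥0∞))
    {V : EuclideanSpace ℝ (Fin 3) → EuclideanSpace ℝ (Fin 3)} {P : EuclideanSpace ℝ (Fin 3) → ℝ}
    (hu : ∀ τ : ℝ, τ < 0 → u τ = fun x => selfSimilarCollapse (1 / (2 + ρ)) T V τ (x - x₀))
    (hp : ∀ τ : ℝ, τ < 0 → p τ = fun x => selfSimilarCollapsePressure (1 / (2 + ρ)) T P τ (x - x₀))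
    (hV : ContDiff ℝ 2 V) {κ R₁ : ℝ} (hκ : κ < 1 / (2 + ρ))
    (hR₁ : ∀ y : EuclideanSpace ℝ (Fin 3), R₁ ≤ ‖y‖ → -(κ * ‖y‖ ^ 2) ≤ ⟪y, V y⟫) :
    uncurry u =ᵐ[volume.restrict (Iio (0 : ℝ) ×ˢ (univ : Set (EuclideanSpace ℝ (Fin 3))))] 0 := by
  have h2ρ : (0 : ℝ) < 2 + ρ := by linarith
  have hγ : (0 : ℝ) < 1 / (2 + ρ) := one_div_pos.2 h2ρ
  have hγ2 : 1 / (2 + ρ) < 1 / 2 := one_div_lt_one_div_of_lt two_pos (by linarith)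
  -- the extension, `P ∈ L¹_loc`, CIV (3.3) classically
  have hext := isDistributional_selfSimilarCollapse_of_shifted hT x₀ hsol hu hp
  have hpm : AEStronglyMeasurable (uncurry (selfSimilarCollapsePressure (1 / (2 + ρ)) 0 P))
      (volume.restrict (Iio (0 : ℝ) ×ˢ (univ : Set (EuclideanSpace ℝ (Fin 3))))) := by
    have := hext.2.2.1.aestronglyMeasurable
    simpa [slab] using this
  have hPm : AEStronglyMeasurable P volume :=
    aestronglyMeasurable_pressureProfile (p := selfSimilarCollapsePressure (1 / (2 + ρ)) 0 P) hpm fun _ _ => rfl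
  have hP1 : LocallyIntegrable P volume :=
    locallyIntegrable_pressureProfile_of_slab hγ.le (by linarith) hPm hext.2.2.1
  obtain ⟨P', hprof⟩ := WeakToClassical.exists_isSelfSimilarEulerProfile_of_contDiff hext
    (fun _ _ => rfl) (fun _ _ => rfl) hV hP1
  -- irrotational by the one-sided radial barrier on half-orbits (ns-typeII-p1 g8)
  have hcurl : ∀ x, curl V x = 0 := fun x => Loc.curl_eq_zero_of_radialInflow hprof hκ hR₁ hγ hγ2 x
  exact selfSimilar_ae_eq_zero_of_irrotationalC2_profile hρ hρh hT x₀ hsol hA hu hp hV hcurl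

end Shifted

end Summit.NavierStokesRegularity.NavierStokesRegularity.Theorems.PowerGaugeEulerLiouville

end
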